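import Mathlib.Algebra.Order.Ring.Abs
import Mathlib.Order.Filter.Extr
import Mathlib.Tactic.Linarith
import Mathlib.Tactic.NormNum
import Mathlib.Tactic.Ring
import HarnessLib

/-!
# Rosenberg's penalty quadratization of pseudo-Boolean functions

Topic `Literature/Combinatorics/Optimization` (pub-qadeq lane; the vocabulary of 'quadratized
baselines' for the higher-order binary optimisation (HUBO) rows, CLAIMS E-42 / S-13 — whose printed
classical comparators are simulated annealing and hybrid quantum annealing "run on the QUADRATIZED
problem with dimod/dwave-system at DEFAULT settings, penalty ∈ {1, 2, 5, 10, 30}" — and E-29 / E-43).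

HONEST FRAMING: instance-level adjudication of specific advantage claims; no claim about BQP vs BPP
or the summit. Nothing here says anything about any solver, instance family or running time; the file
records, as printed and with proofs, the penalty-function reduction of a higher-degree pseudo-Boolean
minimisation to a quadratic one and the CONDITION on the penalty multiplier under which the two
problems have the same minima — so that a lane report can state, for a given quadratized baseline,
whether its penalty strength meets the printed sufficient condition.

## Source (verbatim)

[BorosGruber2014] E. Boros, A. Gruber, *On Quadratization of Pseudo-Boolean Functions*, ISAIM 2014
= arXiv:1404.6538, §2 and §2.1 (held text `paper:arxiv-1404.6538` p0004):
* §2: "we are looking for a quadratic pseudo-Boolean function `g(x, w)`, where `w ∈ 𝔹^m` is a set of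
  'new' variables, such that the equality `f(x) = min_{w ∈ 𝔹^m} g(x, w)` holds for all `x ∈ 𝔹^n`. We
  shall call such a `g` the quadratization of `f`."
* §2.1: "Let us first recall the quadratization method suggested by [Ros75], based on the idea of
  traditional penalty functions. This method replaces a product `xy` of two binary variables by a
  new binary variable `w` …, and adds to `f` a quadratic penalty function `p(x, y, w)` such that
  `p(x, y, w) = 0` if `w = xy`, `≥ 1` otherwise. Since `f` is multilinear, we can write it as
  `f = xyA + B`, where `A` is a multilinear polynomial not involving `x` and `y`, and where `B` is a
  multilinear polynomial not involving the product `xy`. Assume now that `p` is a quadratic function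
  satisfying (e-rosenberg), and `M` is a positive real with `M > max |A|`, where the maximization is
  taken over all binary assignments of the variables of `A`. Then, the function `f̃ = zA + B + Mp`
  on `n + 1` variables has the same minima as `f`. [Ros75] showed that
  `p(x, y, w) = xy − 2xw − 2yw + 3w` is a quadratic function satisfying (e-rosenberg)."
  ([Ros75] = [Rosenberg1975].)

[KimEtAl2026DQOF] S. Kim et al., *Distributed Quantum Optimization for Large-Scale Higher-Order Problems
with Dense Interactions*, arXiv:2604.20599 (2026) — the primary of CLAIMS E-42, whose quadratized
baselines use this very penalty — Supplementary Note 2, eq. (7)–(9), p. 27 (held text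
`paper:arxiv-2604.20599` p0027 L16–33): "Consider a cubic interaction term `v_{1,2,3} x_1 x_2 x_3`.
Introducing an auxiliary binary variable `x_{N+1} = x_1 x_2` allows the cubic term to be rewritten in
quadratic form as `v_{1,2,3} x_1 x_2 x_3 → v_{1,2,3} x_{N+1} x_3` (7) … The relation `x_{N+1} = x_1 x_2`
is enforced by augmenting the objective with a penalty term weighted by a positive strength parameter
`M`: `min_{x_{N+1}} (v_{1,2,3} x_{N+1} x_3 + M P(x_1, x_2, x_{N+1}))` (8), where the penalty function is
defined as `P(x_1, x_2, x_{N+1}) = 3x_{N+1} + x_1x_2 − 2x_1x_{N+1} − 2x_2x_{N+1}` (9). For binary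
variables, `P(x_1, x_2, x_{N+1}) = 0` if `x_{N+1} = x_1x_2`, and is strictly positive otherwise";
Supplementary Note 3, p. 28: "quadratization penalty strengths are varied across values of 1, 2, 5, 10,
and 30"; Fig. 3 caption, p. 9: "The quadratization penalty strength is fixed at 5 for SA and HQA."

## Contents (all proved; 0 named facts; standard axioms)

* `bit : Bool → R` (the 0/1 value of a binary variable), `penalty x y w = xy − 2xw − 2yw + 3w`
  ([Rosenberg1975] via [BorosGruber2014] §2.1);
* **`penalty_eq_zero_iff`** (`p = 0 ↔ w = xy`), **`one_le_penalty_of_ne`** (`p ≥ 1` otherwise),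
  `penalty_nonneg`, `penalty_le_three`;
* the substitution `substitute A B M` (`f̃ = wA + B + Mp` for `f = xyA + B`, with the "other
  variables" an arbitrary type `V`): `substitute_self` (at `w = xy` it returns `f`),
  **`lt_substitute_of_ne`** (for `|A| < M` every wrong `w` is strictly worse),
  **`min_substitute_eq`** (`min_w f̃(x, y, w, v) = f(x, y, v)`: `f̃` is a quadratization of `f` in
  the sense of §2), **`isMinOn_substitute_iff`** ("`f̃` has the same minima as `f`": a point minimises
  `f̃` iff its `w` equals `xy` and its `(x, y, v)` minimises `f`);
* a private `decide`/`norm_num` instance showing the hypothesis `M > max |A|` is not idle: with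
  `A = −3`, `B = 5y`, `M = 2` the substituted function reaches `−1 < 0 = min f`.

Not covered: multilinear polynomial REPRESENTATIONS (the file works with functions of the binary
variables; "`A` not involving `x, y`" is expressed by `A : V → R`), the recursive application until
the function is quadratic and its `O(n^{2 log d})` variable count, the other quadratizations of the
source (Freedman–Drineas, Ishikawa, §3–§4), submodularity.

## References

* [BorosGruber2014] arXiv:1404.6538 (ISAIM 2014), §2, §2.1.
* [Rosenberg1975] I. G. Rosenberg, *Reduction of bivalent maximization to the quadratic case*,
  Cahiers du Centre d'Études de Recherche Opérationnelle 17 (1975) 71–74 (cited through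
  [BorosGruber2014]).
* [KimEtAl2026DQOF] arXiv:2604.20599, Supplementary Notes 2–3 (p. 27–28), Fig. 3 (p. 9).
-/

namespace Literature.Combinatorics.Optimization

namespace Rosenberg

section Basic

variable {R : Type*} [CommRing R]

/-- The `0/1` value of a binary variable. [cite: BorosGruber2014, §1 ("x_j ∈ 𝔹 = {0,1}")] -/
def bit (b : Bool) : R := if b then 1 else 0

/-- `bit 1 = 1`. [cite: BorosGruber2014, §1 ("x_j ∈ 𝔹 = {0,1}")] -/
@[simp] theorem bit_true : (bit true : R) = 1 := rfl

/-- `bit 0 = 0`. [cite: BorosGruber2014, §1 ("x_j ∈ 𝔹 = {0,1}")] -/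
@[simp] theorem bit_false : (bit false : R) = 0 := rfl

/-- `bit (x && y) = bit x * bit y`: the product of two binary variables is their conjunction.
[cite: BorosGruber2014, §2.1 ("replaces a product xy of two binary variables by a new binary
variable w")] -/
theorem bit_and (x y : Bool) : (bit (x && y) : R) = bit x * bit y := by
  cases x <;> cases y <;> simp

/-- **Rosenberg's penalty** `p(x, y, w) = xy − 2xw − 2yw + 3w`.
[cite: BorosGruber2014, §2.1 ("[Ros75] showed that p(x,y,w) = xy − 2xw − 2yw + 3w")]
[cite: Rosenberg1975, main construction] [cite: KimEtAl2026DQOF, SN2 eq. (9)] -/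
def penalty (x y w : Bool) : R :=
  bit x * bit y - 2 * bit x * bit w - 2 * bit y * bit w + 3 * bit w

/-- The eight values of the penalty. [cite: BorosGruber2014, §2.1 eq. (e-rosenberg)] -/
theorem penalty_eq (x y w : Bool) :
    (penalty x y w : R) =
      (if w then (if x then (if y then 0 else 1) else (if y then 1 else 3))
       else (if x then (if y then 1 else 0) else 0)) := by
  cases x <;> cases y <;> cases w <;> simp [penalty] <;> norm_num

end Basic

section Ordered

variable {R : Type*} [CommRing R] [LinearOrder R] [IsStrictOrderedRing R]

/-- **`p(x, y, w) = 0` iff `w = xy`.** [cite: BorosGruber2014, §2.1 eq. (e-rosenberg) ("= 0 if w = xy")]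
[cite: KimEtAl2026DQOF, SN2 after eq. (9) ("P = 0 if x_{N+1} = x_1x_2")] -/
theorem penalty_eq_zero_iff (x y w : Bool) : (penalty x y w : R) = 0 ↔ w = (x && y) := by
  rw [penalty_eq]
  cases x <;> cases y <;> cases w <;> simp

/-- **`p(x, y, w) ≥ 1` otherwise** (in particular "strictly positive otherwise").
[cite: BorosGruber2014, §2.1 eq. (e-rosenberg) ("≥ 1 otherwise")]
[cite: KimEtAl2026DQOF, SN2 after eq. (9) ("and is strictly positive otherwise")] -/
theorem one_le_penalty_of_ne {x y w : Bool} (h : w ≠ (x && y)) : (1 : R) ≤ penalty x y w := by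
  rw [penalty_eq]
  cases x <;> cases y <;> cases w <;> simp_all

/-- `p ≥ 0` on binary arguments. [cite: BorosGruber2014, §2.1 eq. (e-rosenberg)] -/
theorem penalty_nonneg (x y w : Bool) : (0 : R) ≤ penalty x y w := by
  rw [penalty_eq]
  cases x <;> cases y <;> cases w <;> simp

/-- `p ≤ 3` on binary arguments (the value at `x = y = 0`, `w = 1`). [cite: BorosGruber2014, §2.1] -/
theorem penalty_le_three (x y w : Bool) : (penalty x y w : R) ≤ 3 := by
  rw [penalty_eq]
  cases x <;> cases y <;> cases w <;> simp

/-! ### The substitution `f = xyA + B ↦ f̃ = wA + B + Mp` -/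

variable {V : Type*}

/-- A function of the form `f = xyA + B` with `A` not involving `x, y` (`A : V → R`, `V` the
assignment type of the other variables) and `B` not involving the product `xy` (any function of
`x`, `y` and the other variables). [cite: BorosGruber2014, §2.1 ("we can write it as f = xyA + B")] -/
def withProduct (A : V → R) (B : Bool → Bool → V → R) (x y : Bool) (v : V) : R :=
  bit x * bit y * A v + B x y v

/-- **Rosenberg's substituted function** `f̃(x, y, w, v) = wA + B + M·p(x, y, w)` on one more binary
variable. [cite: BorosGruber2014, §2.1 ("the function f̃ = zA + B + Mp on n + 1 variables")]
[cite: KimEtAl2026DQOF, SN2 eq. (7)–(8) (v x_{N+1} x_3 + M P(x_1, x_2, x_{N+1}))] -/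
def substitute (A : V → R) (B : Bool → Bool → V → R) (M : R) (x y w : Bool) (v : V) : R :=
  bit w * A v + B x y v + M * penalty x y w

/-- At the consistent value `w = xy` the substituted function IS `f`. [cite: BorosGruber2014, §2.1] -/
theorem substitute_self (A : V → R) (B : Bool → Bool → V → R) (M : R) (x y : Bool) (v : V) :
    substitute A B M x y (x && y) v = withProduct A B x y v := by
  simp [substitute, withProduct, (penalty_eq_zero_iff x y (x && y)).mpr rfl, bit_and]

/-- **Every inconsistent `w` is strictly worse** once `M > |A|`:
`f(x, y, v) < f̃(x, y, w, v)` for `w ≠ xy`. [cite: BorosGruber2014, §2.1 ("M is a positive real with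
M > max |A| … has the same minima as f")] -/
theorem lt_substitute_of_ne {A : V → R} (B : Bool → Bool → V → R) {M : R} {v : V}
    (hM : |A v| < M) {x y w : Bool} (hw : w ≠ (x && y)) :
    withProduct A B x y v < substitute A B M x y w v := by
  have hp : (1 : R) ≤ penalty x y w := one_le_penalty_of_ne hw
  have hM0 : 0 ≤ M := (abs_nonneg _).trans hM.le
  have hMp : M ≤ M * penalty x y w := by
    simpa using mul_le_mul_of_nonneg_left hp hM0
  have hA := abs_lt.mp hM
  unfold withProduct substitute
  cases x <;> cases y <;> cases w <;> simp_all <;> nlinarith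

/-- `f ≤ f̃` pointwise (with equality at `w = xy`). [cite: BorosGruber2014, §2.1] -/
theorem withProduct_le_substitute {A : V → R} (B : Bool → Bool → V → R) {M : R} {v : V}
    (hM : |A v| < M) (x y w : Bool) :
    withProduct A B x y v ≤ substitute A B M x y w v := by
  by_cases hw : w = (x && y)
  · rw [hw, substitute_self]
  · exact (lt_substitute_of_ne B hM hw).le

/-- **`f̃` is a quadratization of `f`** in the sense of §2: `min_{w ∈ 𝔹} f̃(x, y, w, v) = f(x, y, v)`
for all binary `x, y` and all `v`. [cite: BorosGruber2014, §2 eq. (e-model) with §2.1] -/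
theorem min_substitute_eq {A : V → R} (B : Bool → Bool → V → R) {M : R} {v : V}
    (hM : |A v| < M) (x y : Bool) :
    min (substitute A B M x y false v) (substitute A B M x y true v) = withProduct A B x y v := by
  apply le_antisymm
  · cases hxy : (x && y)
    · exact (min_le_left _ _).trans (by rw [← hxy, substitute_self])
    · exact (min_le_right _ _).trans (by rw [← hxy, substitute_self])
  · exact le_min (withProduct_le_substitute B hM x y false) (withProduct_le_substitute B hM x y true)

/-- **"`f̃` has the same minima as `f`"**: with `M > |A(v)|` for every assignment `v` of the other
variables, `(x, y, w, v)` is a global minimiser of `f̃` iff `w = xy` and `(x, y, v)` is a global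
minimiser of `f`. [cite: BorosGruber2014, §2.1 ("Then, the function f̃ = zA + B + Mp on n + 1
variables has the same minima as f")] [cite: Rosenberg1975, main theorem] -/
theorem isMinOn_substitute_iff {A : V → R} (B : Bool → Bool → V → R) {M : R}
    (hM : ∀ v, |A v| < M) (x y w : Bool) (v : V) :
    IsMinOn (fun q : Bool × Bool × Bool × V => substitute A B M q.1 q.2.1 q.2.2.1 q.2.2.2)
        Set.univ (x, y, w, v) ↔
      w = (x && y) ∧
        IsMinOn (fun q : Bool × Bool × V => withProduct A B q.1 q.2.1 q.2.2) Set.univ (x, y, v) := by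
  simp only [isMinOn_univ_iff]
  constructor
  · intro h
    have hw : w = (x && y) := by
      by_contra hne
      have h1 := h (x, y, (x && y), v)
      simp only [substitute_self] at h1
      exact absurd (lt_substitute_of_ne B (hM v) hne) (not_lt.mpr h1)
    refine ⟨hw, ?_⟩
    intro q
    have h1 := h (q.1, q.2.1, (q.1 && q.2.1), q.2.2)
    simp only [substitute_self] at h1
    rw [hw, substitute_self] at h1
    exact h1
  · rintro ⟨hw, h⟩ q
    rw [hw, substitute_self]
    exact (h (q.1, q.2.1, q.2.2.2)).trans (withProduct_le_substitute B (hM q.2.2.2) _ _ _)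

/-- The value of `min f̃` equals `min f` pointwise-in-`(x, y, v)`: a lower bound of `f` is a lower
bound of `f̃` and conversely. [cite: BorosGruber2014, §2 eq. (e-model), §2.1] -/
theorem lowerBound_iff {A : V → R} (B : Bool → Bool → V → R) {M : R} (hM : ∀ v, |A v| < M)
    (c : R) :
    (∀ x y w v, c ≤ substitute A B M x y w v) ↔ ∀ x y v, c ≤ withProduct A B x y v := by
  constructor
  · intro h x y v
    simpa [substitute_self] using h x y (x && y) v
  · intro h x y w v
    exact (h x y v).trans (withProduct_le_substitute B (hM v) x y w)

/-! A sanity instance (not a cited statement): the hypothesis `M > max |A|` is not idle. With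
`A = −3`, `B = 5y` (so `f = −3xy + 5y`, whose minimum over `𝔹²` is `0`) and the INSUFFICIENT multiplier
`M = 2 < 3 = |A|`, the substituted function takes the value `−1 < 0` at `(x, y, w) = (1, 0, 1)`, a point
with `w ≠ xy`: the quadratized problem no longer has the same minima. -/

/-- Sanity instance datum `A = −3` (plumbing for the example below). [folklore] -/
private def exA : Unit → ℤ := fun _ => -3

/-- Sanity instance datum `B = 5y` (plumbing for the example below). [folklore] -/
private def exB : Bool → Bool → Unit → ℤ := fun _ y _ => 5 * bit y

example : (∀ x y : Bool, (0 : ℤ) ≤ withProduct exA exB x y ()) ∧ withProduct exA exB false false () = 0 ∧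
    substitute exA exB 2 true false true () = -1 := by
  refine ⟨?_, ?_, ?_⟩
  · intro x y; cases x <;> cases y <;> simp [withProduct, exA, exB]
  · simp [withProduct, exA, exB]
  · simp [substitute, exA, exB, penalty]

/-- **[KimEtAl2026DQOF] SN2 eq. (8) for one cubic term**: for a strength `M > |v x₃|` (in particular
`M > |v|`), `min_{x_{N+1} ∈ 𝔹} (v x_{N+1} x₃ + M·P(x₁, x₂, x_{N+1})) = v x₁ x₂ x₃` — the single-term case
of `min_substitute_eq` (`A = v·x₃`, `B = 0`). [cite: KimEtAl2026DQOF, SN2 eq. (7)–(9)]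
[cite: BorosGruber2014, §2.1] -/
theorem min_cubicTerm_eq (v M : R) (hM : |v| < M) (x₁ x₂ x₃ : Bool) :
    min (substitute (fun u : Bool => v * bit u) (fun _ _ _ => 0) M x₁ x₂ false x₃)
        (substitute (fun u : Bool => v * bit u) (fun _ _ _ => 0) M x₁ x₂ true x₃) =
      v * bit x₁ * bit x₂ * bit x₃ := by
  have hM' : |(fun u : Bool => v * bit u) x₃| < M := by
    show |v * bit x₃| < M
    cases x₃
    · simpa using (abs_nonneg v).trans_lt hM
    · simpa using hM
  rw [min_substitute_eq (A := fun u : Bool => v * bit u) (v := x₃) (fun _ _ _ => (0 : R)) hM' x₁ x₂,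
    withProduct]
  ring

end Ordered

end Rosenberg

end Literature.Combinatorics.Optimization
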